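import Summits.BirchSwinnertonDyer.Rank1Residual.X4.OptimalPeriod
import Literature.NumberTheory.EllipticCurves.AgasheRibetStein2006.ManinConstantOptimalCurves
import HarnessLib

/-!
# Class X4, the 37 Kurihara census pairs at an additive prime: the per-pair kernel shape with EVERY
# non-certificate input BY NAME (cell `b2b-bsdres`, unit `b2b-bsdres-additive-p3`; sibling of
# `X4/KuriharaClasswide[RankOne].lean`, `X4/OptimalPeriod.lean`)

HONEST FRAMING (run/shared/lean/b2b/bsd-rank1-residual/, verbatim in every file): the goal of the
cell is to DELETE the COMBINATION-SHAPED residual classes of the Birch–Swinnerton-Dyer formula for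
ALL analytic-rank `≤ 1` elliptic curves over `ℚ` — "full BSD formula for every rank `≤ 1` curve in
class `C`" assembled STRICTLY from published theorems — so that the rank-`≤ 1` remainder becomes
exactly the CONSTRUCTION-SHAPED classes, which are TYPED (missing-input `Prop`s), NOT attempted.
This is not "finishing BSD". Research route; no claim beyond the stated classes. X4 stays
CONSTRUCTION-SHAPED; nothing below is a class theorem; NOTHING IS BOOKED HERE (bookings are the
lane's: two engines + referee).

Theorems only (no definition, no named fact). For a globally minimal curve `W` whose pair
`(W, N)` is one of the 37 rows of `AgasheRibetStein2006.cremonaCurveOneX4Kurihara` (the open X4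
census pairs inside the boundary of the Kurihara route at `p ∈ {5, 7}`, `N < 2·10⁴`: 11 of analytic
rank `0` with `#Ш_an = 25`, 26 of analytic rank `1`; harvest-2 HARVEST.md E21), Miller's `BSD(E,p)`
follows from the NAMED inputs

* `h26` = Agashe–Ribet–Stein 2006 Thm. 2.6 / Thm. 5.2 first sentence (`|c| = 1` for optimal curves
  of conductor `≤ 130000`), `h52` = Thm. 5.2 second sentence on the 37 classes (the curve `…1` is
  optimal) — together Kim's Manin hypothesis AND (via `X4.periodTransfer_of_optimal`,
  `Ω(W) = |c|·Ω⁺_f`) the period-transfer binder;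
* `hKim` = Kim 2026 Thm. 1.8 (6) in its any-reduction shape (rank `0`:
  `Kim2022_rankZero_padicValRat_sha_of_kuriharaNumber_ne_zero_of_maninConstant`; rank `1`:
  `Kim2022_rankOne_card_sha_eq_one_of_kuriharaNumber_ne_zero_of_maninConstant`);
* `hGZK` = Gross–Zagier–Kolyvagin (`rank_eq_analyticRank_of_analyticRank_le_one`);

and the PER-PAIR CLAIMS (the lane's two-engine values; nothing of them is computed in the kernel):
`p ≥ 5`; `ρ̄_{E,p}` onto (galrep, two readings); `L(E,1) ≠ 0` (rank `0`) / `L(E,1) = 0 ∧ r_an = 1`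
(rank `1`); `p ∤ ∏ c_ℓ` (rank `0`) / `#Ш_an = q` with `ord_p q = 0` (rank `1`); and the CERTIFICATE
— for every OPTIMAL datum `D` of `W` at level `N` (its `D.f` is the newform of `W`), a cyclic
`𝒩₁`-level (rank `0`) / a cyclic Kolyvagin prime (rank `1`) with a unit mod-`p` Kurihara number of
`D.f` (`KuriharaUnitAt` / `KuriharaUnitPrimeAt`; harvest-2 E21.10–E21.12: 11/11 three-engine at
`ν = 2`, 26/26 at `ν = 1`, 29/37 multi-engine). Per pair; NOT a class theorem: class-wide the
certificate is Kato's IMC (Kim Thm. 1.10), see `X4/KuriharaClasswide.lean`.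

References: [AgasheRibetStein2006] Thm. 2.6, appendix Thm. 5.2; [Kim2022StructureSelmer] Thm. 1.8,
Thm. 1.10, §1.3.5; [Miller2011LMS] Def. 1.1; cell files REFEREE.md R82.4,
b2b-bsdres-additive-p3/KURIHARA-CLASSWIDE.md.
-/

noncomputable section

open scoped Classical MatrixGroups ModularForm

open CongruenceSubgroup WeierstrassCurve Literature.NumberTheory.EllipticCurves
  Literature.NumberTheory.EllipticCurves.ModularForms
  Literature.NumberTheory.EllipticCurves.AgasheRibetStein2006
  Literature.NumberTheory.EllipticCurves.Rank1Residual
  Literature.NumberTheory.EllipticCurves.Rank1Residual.Typed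

namespace Summit.BirchSwinnertonDyer.Rank1Residual.X4

variable (W : WeierstrassCurve ℚ) [W.IsElliptic] [W.IsGloballyMinimal] (N : ℕ) [NeZero N]
  (p : ℕ) [Fact p.Prime]

/-- **Rank `0`, one of the 37 census classes**: ARS 2006 (`h26`, `h52`: the curve `…1` of the class
carries an OPTIMAL datum with `|c| = 1`) + Kim 2026 Thm. 1.8 (6) any-reduction (`hKim`) + GZK
(`hGZK`), with the per-pair claims `p ≥ 5`, `ρ̄` onto, `L(E,1) ≠ 0`, `p ∤ ∏ c_ℓ`, and the certificate
`KuriharaUnitAt W p D.f` for every optimal datum `D` at level `N` ⇒ Miller's `BSD(E,p)`. No period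
binder, no torsion binder, no Manin binder. Per pair; NOT a class theorem.
[cite: AgasheRibetStein2006, Thm. 2.6 and appendix Thm. 5.2] [cite: Kim2022StructureSelmer, Thm. 1.8 (6) (journal)]
[cite: Miller2011LMS, Def. 1.1] -/
theorem bsdp_of_mem_x4Kurihara_of_kim_rankZero
    (h26 : cremona_abs_maninConstant_eq_one_of_level_le) (h52 : cremona_optimal_curveOne_x4Kurihara)
    (hKim : Kim2022_rankZero_padicValRat_sha_of_kuriharaNumber_ne_zero_of_maninConstant)
    (hGZK : rank_eq_analyticRank_of_analyticRank_le_one)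
    (hmem : (W, N) ∈ cremonaCurveOneX4Kurihara) (hp : 5 ≤ p)
    (hsurj : W.HasSurjectiveModNGaloisRep p) (hL : W.entireLFunction 1 ≠ 0)
    (htam : ¬ p ∣ W.tamagawaProduct)
    (hK : ∀ D : ModularParametrizationData W N,
      (∀ z ∈ D.L.lattice, ∃ w ∈ periodLattice D.f, z = D.c * w) → KuriharaUnitAt W p D.f) :
    BSDp W p := by
  obtain ⟨D, hopt, -, hc⟩ := exists_optimal_abs_maninConstant_eq_one_of_mem_x4Kurihara h26 h52 W N hmem
  obtain ⟨n, hn0, hn, hcyc, ψ, hψ, hδ⟩ := hK D hopt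
  exact bsdp_of_kim_rankZero_of_optimal W p hKim hGZK hp hsurj hL D hopt (hc p Fact.out) htam n hn
    hcyc ψ hψ hδ

/-- **Rank `1`, one of the 37 census classes**: ARS 2006 (`h26`, `h52`) + Kim 2026 Thm. 1.8 (1),
(4), (6) any-reduction (`hKim`) + GZK (`hGZK`), with the per-pair claims `p ≥ 5`, `ρ̄` onto,
`L(E,1) = 0`, `r_an = 1`, `#Ш_an = q` with `ord_p q = 0`, and the certificate `KuriharaUnitPrimeAt W p D.f`
for every optimal datum `D` at level `N` ⇒ Miller's `BSD(E,p)`. Per pair; NOT a class theorem.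
[cite: AgasheRibetStein2006, Thm. 2.6 and appendix Thm. 5.2] [cite: Kim2022StructureSelmer, Thm. 1.8 (1), (4), (6) (journal)]
[cite: Miller2011LMS, Def. 1.1] -/
theorem bsdp_of_mem_x4Kurihara_of_kim_rankOne
    (h26 : cremona_abs_maninConstant_eq_one_of_level_le) (h52 : cremona_optimal_curveOne_x4Kurihara)
    (hKim : Kim2022_rankOne_card_sha_eq_one_of_kuriharaNumber_ne_zero_of_maninConstant)
    (hGZK : rank_eq_analyticRank_of_analyticRank_le_one)
    (hmem : (W, N) ∈ cremonaCurveOneX4Kurihara) (hp : 5 ≤ p)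
    (hsurj : W.HasSurjectiveModNGaloisRep p) (hL : W.entireLFunction 1 = 0)
    (hr : W.analyticRank = 1) {q : ℚ} (hq : shaAn W = (q : ℂ)) (hv : padicValRat p q = 0)
    (hK : ∀ D : ModularParametrizationData W N,
      (∀ z ∈ D.L.lattice, ∃ w ∈ periodLattice D.f, z = D.c * w) → KuriharaUnitPrimeAt W p D.f) :
    BSDp W p := by
  obtain ⟨D, hopt, -, hc⟩ := exists_optimal_abs_maninConstant_eq_one_of_mem_x4Kurihara h26 h52 W N hmem
  obtain ⟨ℓ, hℓF, hℓ, hcyc, ψ, hψ, hδ⟩ := hK D hopt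
  exact bsdp_of_kim_rankOne_of_optimal W p hKim hGZK hp hsurj hL hr D hopt (hc p Fact.out) ℓ hℓ hcyc
    ψ hψ hδ hq hv

/-- **Rank `0`, census class, EXACT residue**: with the certificate in hand, `BSD(E,p) ⟺ p ∤ ∏ c_ℓ`
— so on a Tamagawa-obstructed member of the list a unit certificate cannot occur granted `BSD(E,p)`
(none of the 37 is Tamagawa-obstructed; said for completeness). Per pair.
[cite: AgasheRibetStein2006, Thm. 2.6 and appendix Thm. 5.2] [cite: Kim2022StructureSelmer, Thm. 1.8 (6) and Conj. 1.9 (journal)]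
[cite: Miller2011LMS, Def. 1.1] -/
theorem bsdp_iff_not_dvd_tamagawaProduct_of_mem_x4Kurihara
    (h26 : cremona_abs_maninConstant_eq_one_of_level_le) (h52 : cremona_optimal_curveOne_x4Kurihara)
    (hKim : Kim2022_rankZero_padicValRat_sha_of_kuriharaNumber_ne_zero_of_maninConstant)
    (hGZK : rank_eq_analyticRank_of_analyticRank_le_one)
    (hmem : (W, N) ∈ cremonaCurveOneX4Kurihara) (hp : 5 ≤ p)
    (hsurj : W.HasSurjectiveModNGaloisRep p) (hL : W.entireLFunction 1 ≠ 0)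
    (hK : ∀ D : ModularParametrizationData W N,
      (∀ z ∈ D.L.lattice, ∃ w ∈ periodLattice D.f, z = D.c * w) → KuriharaUnitAt W p D.f) :
    BSDp W p ↔ ¬ p ∣ W.tamagawaProduct := by
  obtain ⟨D, hopt, -, hc⟩ := exists_optimal_abs_maninConstant_eq_one_of_mem_x4Kurihara h26 h52 W N hmem
  obtain ⟨n, hn0, hn, hcyc, ψ, hψ, hδ⟩ := hK D hopt
  exact bsdp_iff_not_dvd_tamagawaProduct_of_kim_rankZero W p hKim hGZK hp hsurj hL D (hc p Fact.out)
    (periodTransfer_of_optimal p D hopt (hc p Fact.out)) n hn hcyc ψ hψ hδ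

/-- The eleven rank-`0` census curves are rows of the table, e.g. `2900d1 = [0,0,0,-120775,-16155250]`
at level `2900` (membership by evaluation of the literal list). [cite: Cremona1997, Table 1 (class 2900d)] -/
theorem mem_x4Kurihara_2900d1 :
    ((⟨0, 0, 0, -120775, -16155250⟩ : WeierstrassCurve ℚ), 2900) ∈ cremonaCurveOneX4Kurihara := by
  simp [cremonaCurveOneX4Kurihara]

end Summit.BirchSwinnertonDyer.Rank1Residual.X4

end
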